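import Literature.Probability.Percolation.LoopRotationInvarianceCouplingProofs
import HarnessLib

/-!
# DKKMO Theorem 1.9 (`q = 1`) is a corollary of Theorem 1.7: pairwise closeness of the `φ_{L(α)}`

Sorry-free companion of `Literature.Probability.Percolation.IsoradialRectangularLoops`
(Duminil-Copin–Kozlowski–Krachun–Manolescu–Oulamara, *Rotational invariance in critical planar
lattice models*, arXiv:2012.11672v2 (2026), §1.4). That file vendors, at `q = 1` and in the
conventions of crit-perc.S25, Theorem 1.7 of the paper as the named fact
`dkkmo_universality_coupling` (asymptotic universality among the isoradial rectangular
lattices `L(α)`: `d_CN(φ_{δL(α)}, φ_{δL(π/2)}) < C δ^c`, constants uniform in `α`).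

The paper's Theorem 1.9 (universality up to linear deformation: "for every `q ∈ [1, 4]` and
`α, β ∈ (0, π)` there exist constants `c, C > 0` and an invertible linear map `M_{β,α}` such
that `d_CN[φ_{δL(β)}, φ_{δL(α)} ∘ M_{β,α}] ≤ C δ^c` for all `δ > 0`") is, as printed,
existential in the linear map, and the paper introduces it as "the following weaker version of
Theorem 1.7", recording that "ignoring the dependence of `c, C` on `α` and `β`, Theorem 1.7 is
equivalent to Theorem 1.9 with the additional input that `M_{π/2,α} = id`" (§1.4, between
Remark 1.8 and Theorem 1.9). It is therefore **not** carried as a separate named fact: this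
file proves it, in the conventions of crit-perc.S25, from `dkkmo_universality_coupling`:

* `dkkmo_universality_coupling.pairwise` — from Theorem 1.7, all the measures `φ_{δL(α)}`,
  `α ∈ (0, π)`, are pairwise `2C δ^c`-close in coupling form, constants uniform in both
  angles (the shape of Proposition 3.13 of the paper, §3.9, once `M_{β,α} = id`);
* `dkkmo_linearDeformation_coupling_of_universality` — Theorem 1.9 at `q = 1` in the printed
  `∃ M` form (tree conventions: the loops of `ω' ∼ φ_{δL(α)}` inside `M(closedBall 0 R)`
  pushed forward by `M⁻¹` are compared with the loops of `ω ∼ φ_{δL(β)}` inside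
  `closedBall 0 R`), with `M = id`.

## The argument

Given Theorem 1.7 at the angles `β` and `α` (same mesh `δ`, same window), the couplings
`(ω_β, ω″)` of `φ_{δL(β)}` with `φ_{δL(π/2)}` and `(ω″, ω_α)` of `φ_{δL(π/2)}` with
`φ_{δL(α)}` glue along their common middle marginal — at fixed positive mesh and bounded
window the loop-collection map of the middle configuration takes finitely many values
(`finite_range_isoRectLoopCollection`), so the elementary gluing `exists_glueCoupling` of
`LoopRotationInvarianceCouplingProofs` applies — and the defects add up through the triangle
inequality for the Hausdorff edistance:
`P[2ε < d(ω_β, ω_α)] ≤ P[ε < d(ω_β, ω″)] + P[ε < d(ω″, ω_α)] ≤ 2ε` with `ε = max(C, 0) δ^c`.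
This is the triangle inequality for the coupling distance `d_CN` on laws (DKKMO §1.2); no
percolation input other than Theorem 1.7 is used. Theorem 1.9 then holds with `M_{β,α} = id`
(the identity deformation acts trivially on loop collections and windows,
`loopSpace_map_refl_symm`).

In the source the logical order is the opposite one: Theorem 1.9 for the explicit drift matrix
`M_{β,α}` of §3 (the display preceding Remark 3.1, built from the lateral and vertical IIC
drifts) is the engine (§3: track exchanges, IIC increments, resampling, stability of
mesoscopic clusters, homotopy control), Theorem 1.2 follows from it and the lattice symmetries
(§4.1), and Theorem 1.7 is Theorem 1.9 plus the identification `M_{π/2,α} = id` (§4.2,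
Lemma 4.4, Lemma 3.2, Proposition 3.13). None of that is formalised here; the tree's cone of
crit-perc.S25 rests on Theorem 1.7 (`dkkmo_universality_coupling`, itself reduced to the
printed `dkkmo_theorem_1_7` in `IsoradialRectangularLoopsBridge`) through Remark 1.8.

## References

* H. Duminil-Copin, K. K. Kozlowski, D. Krachun, I. Manolescu, M. Oulamara, *Rotational
  invariance in critical planar lattice models*, arXiv:2012.11672v2 (2026): §1.2 (the coupling
  form of `d_CN` on laws), §1.4 (Theorem 1.7, Remark 1.8, Theorem 1.9 and the discussion
  between them), §3 (the matrix `M_{β,α}`, Remark 3.1, Lemma 3.2), §3.9 (Proposition 3.13), §4.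
* C. Villani, *Optimal Transport: Old and New*, Grundlehren 338, Springer (2009), Ch. 1
  (the gluing lemma).
-/

noncomputable section

open MeasureTheory Set
open scoped ENNReal Real

namespace Literature.Probability.Percolation

section CritPerc

open LatticeModels

/-- The identity deformation acts trivially on loop collections: pushing a loop collection
forward along (the inverse of) `ContinuousLinearEquiv.refl ℝ ℂ` does nothing
(`CurveClass.map_id`, `LoopSpace.induced_id`). [folklore] -/
theorem loopSpace_map_refl_symm (L : RandomPlanarGeometry.LoopSpace ℂ) :
    RandomPlanarGeometry.LoopSpace.map
        ⟨(ContinuousLinearEquiv.refl ℝ ℂ).symm, (ContinuousLinearEquiv.refl ℝ ℂ).symm.continuous⟩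
        L = L := by
  rw [RandomPlanarGeometry.LoopSpace.map_eq_induced]
  have hmap : RandomPlanarGeometry.CurveClass.map
      (⟨(ContinuousLinearEquiv.refl ℝ ℂ).symm, (ContinuousLinearEquiv.refl ℝ ℂ).symm.continuous⟩ :
        C(ℂ, ℂ)) = id := by
    funext c
    have hid : (⟨(ContinuousLinearEquiv.refl ℝ ℂ).symm,
        (ContinuousLinearEquiv.refl ℝ ℂ).symm.continuous⟩ : C(ℂ, ℂ)) = ContinuousMap.id ℂ := by
      ext z; rfl
    rw [hid, RandomPlanarGeometry.CurveClass.map_id]; rfl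
  rw [hmap, RandomPlanarGeometry.LoopSpace.induced_id]

/-- **Pairwise closeness of the critical percolations on the isoradial rectangular lattices,
from DKKMO's Theorem 1.7 (`q = 1`)** (Duminil-Copin–Kozlowski–Krachun–Manolescu–Oulamara,
arXiv:2012.11672v2 (2026), §1.4; the shape of Proposition 3.13, §3.9, with constants uniform
in both angles). Given the coupling form of Theorem 1.7 at `q = 1`
(`dkkmo_universality_coupling`: for every window radius `R` there are `C`, `c > 0` such that
for all `θ ∈ (0, π)` and `δ ∈ (0, 1]`, `φ_{L(θ)}` and `φ_{L(π/2)}` couple with loop collections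
on `δL(θ)` / `δL(π/2)` inside `closedBall 0 R` at Hausdorff edistance `> C δ^c` with
probability `≤ C δ^c`), for every window radius `R` there are constants `2 max(C, 0)`, `c > 0`
such that for all angles `α, β ∈ (0, π)` and meshes `δ ∈ (0, 1]` the configurations
`ω ∼ φ_{L(β)}`, `ω' ∼ φ_{L(α)}` couple with the interface loops of `ω` drawn on `δL(β)` and of
`ω'` drawn on `δL(α)`, inside `closedBall 0 R`, at Hausdorff edistance `> 2 max(C, 0) δ^c`
with probability `≤ 2 max(C, 0) δ^c`: the two Theorem-1.7 couplings at the angles `β` and `α`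
are glued along the finite-valued loop collection of the common `φ_{δL(π/2)}`-distributed
middle configuration (`exists_glueCoupling`), and the defects add up by the triangle
inequality (the triangle inequality for `d_CN` on laws, §1.2).
[cite: arXiv201211672v2, Thm 1.7] -/
theorem dkkmo_universality_coupling.pairwise (hU : dkkmo_universality_coupling) (R : ℝ) :
    ∃ C c : ℝ, 0 < c ∧ ∀ α ∈ Set.Ioo (0 : ℝ) π, ∀ β ∈ Set.Ioo (0 : ℝ) π, ∀ δ ∈ Set.Ioc (0 : ℝ) 1,
      ∃ P : Measure (BondConfig (Site 2) × BondConfig (Site 2)),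
        P.map Prod.fst = isoRectPercolation β ∧
        P.map Prod.snd = isoRectPercolation α ∧
        P {p | ENNReal.ofReal (C * δ ^ c) <
            edist (isoRectLoopCollection δ β (Metric.closedBall 0 R) p.1)
              (isoRectLoopCollection δ α (Metric.closedBall 0 R) p.2)} ≤
          ENNReal.ofReal (C * δ ^ c) := by
  obtain ⟨C, c, hc, H⟩ := hU R
  refine ⟨2 * max C 0, c, hc, fun α hα β hβ δ hδ ↦ ?_⟩
  have hb : Bornology.IsBounded (Metric.closedBall (0 : ℂ) R) := Metric.isBounded_closedBall
  have hpi : π / 2 ∈ Set.Ioo (0 : ℝ) π := ⟨by positivity, by linarith [Real.pi_pos]⟩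
  -- the common defect `ε = max(C, 0) δ^c ≥ C δ^c`
  obtain ⟨ε, hε⟩ : ∃ ε : ℝ≥0∞, ε = ENNReal.ofReal (max C 0 * δ ^ c) := ⟨_, rfl⟩
  have hCle : ENNReal.ofReal (C * δ ^ c) ≤ ε :=
    hε ▸ ENNReal.ofReal_le_ofReal
      (mul_le_mul_of_nonneg_right (le_max_left _ _) (Real.rpow_nonneg hδ.1.le _))
  have h2 : ENNReal.ofReal (2 * max C 0 * δ ^ c) = ε + ε := by
    rw [hε, ← two_mul, mul_assoc, ENNReal.ofReal_mul (by norm_num : (0 : ℝ) ≤ 2),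
      ENNReal.ofReal_ofNat]
  -- Theorem 1.7 at an angle `θ`, defect relaxed to `ε`
  have cpl : ∀ θ ∈ Set.Ioo (0 : ℝ) π, ∃ P : Measure (BondConfig (Site 2) × BondConfig (Site 2)),
      P.map Prod.fst = isoRectPercolation θ ∧ P.map Prod.snd = isoRectPercolation (π / 2) ∧
      P {p | ε < edist (isoRectLoopCollection δ θ (Metric.closedBall 0 R) p.1)
        (isoRectLoopCollection δ (π / 2) (Metric.closedBall 0 R) p.2)} ≤ ε := by
    intro θ hθ
    obtain ⟨P, h₁, h₂, hP⟩ := H θ hθ δ hδ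
    exact ⟨P, h₁, h₂, (measure_mono fun p hp ↦ lt_of_le_of_lt hCle hp).trans (hP.trans hCle)⟩
  obtain ⟨P₁, h₁f, h₁s, hd₁⟩ := cpl β hβ
  obtain ⟨P₂, h₂f, h₂s, hd₂⟩ := cpl α hα
  haveI : IsProbabilityMeasure P₁ := isProbabilityMeasure_of_map_fst_eq h₁f
  haveI : IsProbabilityMeasure P₂ := isProbabilityMeasure_of_map_fst_eq h₂f
  -- swap the second coupling: `(ω″, ω_α)` with `ω″ ∼ φ_{L(π/2)}` first
  let e : BondConfig (Site 2) × BondConfig (Site 2) ≃ᵐ BondConfig (Site 2) × BondConfig (Site 2) :=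
    MeasurableEquiv.prodComm
  haveI : IsProbabilityMeasure (P₂.map e) :=
    Measure.isProbabilityMeasure_map e.measurable.aemeasurable
  have h₂f' : (P₂.map e).map Prod.fst = isoRectPercolation (π / 2) := by
    rw [Measure.map_map measurable_fst e.measurable]
    have : Prod.fst ∘ ⇑e = Prod.snd := rfl
    rw [this]; exact h₂s
  have h₂s' : (P₂.map e).map Prod.snd = isoRectPercolation α := by
    rw [Measure.map_map measurable_snd e.measurable]
    have : Prod.snd ∘ ⇑e = Prod.fst := rfl
    rw [this]; exact h₂f
  have hd₂' : (P₂.map e) {p | ε <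
      edist (isoRectLoopCollection δ (π / 2) (Metric.closedBall 0 R) p.1)
        (isoRectLoopCollection δ α (Metric.closedBall 0 R) p.2)} ≤ ε := by
    rw [MeasurableEquiv.map_apply]
    refine (measure_mono fun p hp ↦ ?_).trans hd₂
    have hp' : ε < edist (isoRectLoopCollection δ (π / 2) (Metric.closedBall (0 : ℂ) R) p.2)
        (isoRectLoopCollection δ α (Metric.closedBall (0 : ℂ) R) p.1) := hp
    show ε < edist _ _
    rwa [edist_comm]
  -- glue along the (finite-valued, measurable) loop collection of the middle configuration
  have hmT : Measurable (isoRectLoopCollection δ (π / 2) (Metric.closedBall (0 : ℂ) R)) :=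
    measurable_isoRectLoopCollection hδ.1 hpi hb
  have hfin :
      (Set.range (isoRectLoopCollection δ (π / 2) (Metric.closedBall (0 : ℂ) R))).Finite :=
    finite_range_isoRectLoopCollection hδ.1 hpi hb
  have hν : P₁.map Prod.snd = (P₂.map e).map Prod.fst := by rw [h₁s, h₂f']
  obtain ⟨Q, hQf, hQs, hQ⟩ := exists_glueCoupling P₁ (P₂.map e) hmT hfin hν
  refine ⟨Q, by rw [hQf, h₁f], by rw [hQs, h₂s'], ?_⟩
  rw [h2]
  exact (hQ (measurable_isoRectLoopCollection hδ.1 hβ hb)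
    (measurable_isoRectLoopCollection hδ.1 hα hb) ε ε).trans (add_le_add hd₁ hd₂')

/-- **DKKMO Theorem 1.9 at `q = 1` (universality up to linear deformation), coupling form in
the conventions of crit-perc.S25, proved from Theorem 1.7 with `M_{β,α} = id`**
(Duminil-Copin–Kozlowski–Krachun–Manolescu–Oulamara, arXiv:2012.11672v2 (2026), Theorem 1.9:
"for every `q ∈ [1, 4]` and `α, β ∈ (0, π)` there exist constants `c, C > 0` and an
invertible linear map `M_{β,α} : ℝ² → ℝ²` such that
`d_CN[φ_{δL(β)}, φ_{δL(α)} ∘ M_{β,α}] ≤ C δ^c` for all `δ > 0`", i.e. "`ω ∼ φ_{δL(β)}` and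
`ω' ∼ φ_{δL(α)}` may be coupled so that the loop representations of `ω` and `M_{β,α}⁻¹(ω')`
are close"; §1.4: Theorem 1.9 is "the following weaker version of Theorem 1.7", "Theorem 1.7
is equivalent to Theorem 1.9 with the additional input that `M_{π/2,α} = id`"). Rendering:
for all angles `α, β ∈ (0, π)` there is an invertible real-linear map `M` of the plane such
that, for every window radius `R`, there are constants `C`, `c > 0` with: for every mesh
`δ ∈ (0, 1]` the configurations `ω ∼ φ_{L(β)}`, `ω' ∼ φ_{L(α)}` can be coupled so that the
collection of interface loops of `ω` drawn on `δL(β)` inside `closedBall 0 R` and the image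
under `M⁻¹` of the collection of interface loops of `ω'` drawn on `δL(α)` inside
`M(closedBall 0 R)` are at Hausdorff edistance more than `C δ^c` with probability at most
`C δ^c` (based oriented loop classes, every dart a base point, hard centred window, Hausdorff
edistance on `LoopSpace ℂ`, as for `dkkmo_universality_coupling`, with the same caveat on
orientations, base points and window relative to the printed `d_CN`). Obtained from
`dkkmo_universality_coupling.pairwise` with the identity as `M` (constants `2 max(C, 0)`, `c`,
uniform in the angles, which the printed `∃ M, ∃ C c` form does not ask for). Only this easy
direction is proved; the printed proof of Theorem 1.9 for the explicit drift matrix `M_{β,α}`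
of §3 and the identification of `M_{π/2,α}` with the identity (§4.2) are not formalised in
the tree. [cite: arXiv201211672v2, Thm 1.9] -/
theorem dkkmo_linearDeformation_coupling_of_universality (hU : dkkmo_universality_coupling) :
    ∀ α ∈ Set.Ioo (0 : ℝ) π, ∀ β ∈ Set.Ioo (0 : ℝ) π, ∃ M : ℂ ≃L[ℝ] ℂ, ∀ (R : ℝ),
      ∃ C c : ℝ, 0 < c ∧ ∀ δ ∈ Set.Ioc (0 : ℝ) 1,
        ∃ P : Measure (BondConfig (Site 2) × BondConfig (Site 2)),
          P.map Prod.fst = isoRectPercolation β ∧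
          P.map Prod.snd = isoRectPercolation α ∧
          P {p | ENNReal.ofReal (C * δ ^ c) <
              edist (isoRectLoopCollection δ β (Metric.closedBall 0 R) p.1)
                (RandomPlanarGeometry.LoopSpace.map ⟨M.symm, M.symm.continuous⟩
                  (isoRectLoopCollection δ α (M '' Metric.closedBall 0 R) p.2))} ≤
            ENNReal.ofReal (C * δ ^ c) := by
  intro α hα β hβ
  refine ⟨ContinuousLinearEquiv.refl ℝ ℂ, fun R ↦ ?_⟩
  obtain ⟨C, c, hc, H⟩ := hU.pairwise R
  refine ⟨C, c, hc, fun δ hδ ↦ ?_⟩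
  obtain ⟨P, h₁, h₂, hP⟩ := H α hα β hβ δ hδ
  refine ⟨P, h₁, h₂, le_of_eq_of_le (congrArg P ?_) hP⟩
  -- the identity deformation acts trivially on the window and on the loop collection
  have hball : ⇑(ContinuousLinearEquiv.refl ℝ ℂ) '' Metric.closedBall (0 : ℂ) R =
      Metric.closedBall (0 : ℂ) R := by
    rw [ContinuousLinearEquiv.coe_refl', Set.image_id]
  ext p
  simp only [Set.mem_setOf_eq]
  rw [loopSpace_map_refl_symm, hball]

end CritPerc

end Literature.Probability.Percolation

end
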